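import Summits.HodgeConjecture.CorCM.IrreducibleOddWeightsRightIdealsPivot
import HarnessLib

/-!
# Right ideals, III b: the Hecke reading on a torsor —
# `dim Hg(A₀) + dim Hg(A₁) − dim Hg(A₀ × A₁) = dim(w₀ℚ[Γ] ∩ w₁ℚ[Γ])` for the shadows on a Galois pivot

COR-CM (cell `pub-hodgecm2`, binder seat `b16` gen 64, count-neutral claim RIGHT IDEALS, file R3b — abstract `G`-set
level; theorems only, no definition, no named fact, no `sorry`).  NEW as stated, hence under `Summits/`.  HONEST FRAMING:
finite-dimensional linear algebra about the Kubota–Dodson rank of a pair of CM types (`dim Hg(A₀ × A₁)` versus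
`dim Hg(A₀) + dim Hg(A₁)`); `HC_CM` is neither used nor asserted.

SETTING of R3 (`IrreducibleOddWeightsRightIdealsPivot`): pivot maps `r_κ : E_{i_κ} → Y`, fibre-sum spaces `F_κ ≤ MC_κ`,
and, under (H1) `N` transitive on the fibres, (H2) `N` inside the subgroup generated by the pointwise stabilisers,
`dim Hg(A₀) + dim Hg(A₁) − dim Hg(A₀ × A₁) = dim(F₀ ∩ F₁)`.  Here `Y` is a TORSOR: `G` transitive on `Y`, maps `q_σ : Y → Y`
(`σ ∈ Γ`) commuting with `G` and reaching every point from a base point `y₀` — `Y = Hom(M, ℂ)` for `M` NORMAL,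
`q_δ(z) = z ∘ δ` (`δ ∈ Aut(M)`), the setting of gen 63's `IrreducibleOddWeightsShadowIdealsHecke`.

* **`map_span_precomp_eq_span_fibreSum`** — pulling back along the orbit map `g ↦ g·y₀` (injective on `ℚ^Y`) carries
  the span of the HECKE TRANSLATES `w ∘ q_σ` of the shadow `w = r_* u_1(Φ)` onto the fibre-sum space `F`
  (`s_y(g) = w(g·y)` and `(w ∘ q_σ)(g·y₀) = w(g·q_σ y₀)`); `finrank_inf_span_precomp_eq_finrank_inf_fibreSum`.
* **`typeRank_add_typeRank_eq_finrank_inf_span_precomp_of_pivot`** — THE EXACT HECKE FORMULA: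
  **`rank Φ₀ + rank Φ₁ = rank(Φ₀, Φ₁) + 1 + dim(span{w₀ ∘ q_σ} ∩ span{w₁ ∘ q_σ})`**, i.e.
  **`dim Hg(A₀) + dim Hg(A₁) − dim Hg(A₀ × A₁) = dim(w₀ℚ[Γ] ∩ w₁ℚ[Γ])`**, the dimension of the intersection of the RIGHT
  ideals generated by the two shadows in the group ring of `Γ ≅ Y` (under (H1), (H2) and the torsor hypotheses); the
  criterion of `IrreducibleOddWeightsShadowIdealsHecke` (additive iff the right ideals meet in `0`) is its case `= 0`, now
  without surjectivity of the `r_κ` or injectivity of the `q_σ`.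
* **`typeRank_sigmaType_add_one_add_finrank_inf_span_precomp_le`** — unconditionally (torsor hypotheses only)
  `rank(Φ₀, Φ₁) + 1 + dim(w₀ℚ[Γ] ∩ w₁ℚ[Γ]) ≤ rank Φ₀ + rank Φ₁`: every independent common Hecke combination of the shadows
  is an independent unit of the drop `dim Hg(A₀) + dim Hg(A₁) − dim Hg(A₀ × A₁)`.
* CM dress: R4 `IrreducibleOddWeightsRightIdealsPivotCMFields`.

## References

* [Gordon1999HodgeAVSurvey] B. B. Gordon, *A survey of the Hodge conjecture for abelian varieties*, §3 Theorem (Imai,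
  Murty) with proof, 7.5–7.7, 9.4.3.
* [Kubota1965] T. Kubota, *On the field extension by complex multiplication*, Trans. AMS 118 (1965), §2, §4.
* [Shimura1998] G. Shimura, *Abelian Varieties with Complex Multiplication and Modular Functions*, §8.1, §8.3.
* [Deligne1982HodgeCycles] P. Deligne, *Hodge cycles on abelian varieties*, LNM 900 (1982), I.5 (p. 53), I Ex. 3.7.
-/

set_option autoImplicit false

noncomputable section

open scoped BigOperators

universe u v v' w

namespace Summit.HodgeConjecture.CorCM.IrrOdd

open Literature.NumberTheory.ComplexMultiplication

variable {G : Type w} [Group G]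

/-! ### The Hecke reading on a torsor -/

section Torsor

variable {X : Type v} [MulAction G X] [Fintype X] {Y : Type v'} [MulAction G Y] [DecidableEq Y] {Γ : Type*}

/-- **Pull-back along the orbit map identifies Hecke translates with fibre sums.**  `G` transitive on `Y` (towards `y₀`),
`q_σ : Y → Y` commuting with `G` and reaching every point from `y₀`; then the pull-back `f ↦ (g ↦ f(g·y₀))` (injective)
carries `span{w ∘ q_σ : σ}` ONTO the span `F` of the fibre sums, for the shadow `w = r_* u_1(Φ)` of an equivariant `r`.
[cite: Shimura1998, §8.1 and §8.3] -/
theorem map_span_precomp_eq_span_fibreSum (Φ : Set X) (r : X → Y) (hr : ∀ (g : G) (x : X), r (g • x) = g • r x)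
    (q : Γ → Y → Y) (hq : ∀ (σ : Γ) (g : G) (y : Y), q σ (g • y) = g • q σ y) (y₀ : Y)
    (hcov : ∀ y, ∃ σ, q σ y₀ = y) :
    (Submodule.span ℚ (Set.range fun σ : Γ => fun y : Y =>
        ∑ x ∈ Finset.univ.filter (fun x => r x = q σ y), antiVec Φ (1 : G) x)).map
        (LinearMap.funLeft ℚ ℚ fun g : G => g • y₀) =
      Submodule.span ℚ (Set.range fun y : Y => fun g : G =>
        ∑ x ∈ Finset.univ.filter (fun x => r x = y), antiVec Φ g x) := by
  rw [Submodule.map_span, ← Set.range_comp]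
  congr 1
  ext c
  simp only [Set.mem_range, Function.comp_apply]
  constructor
  · rintro ⟨σ, rfl⟩
    refine ⟨q σ y₀, funext fun g => ?_⟩
    rw [LinearMap.funLeft_apply, hq, fibreSum_apply_eq_shadow_smul Φ r hr (q σ y₀) g]
  · rintro ⟨y, rfl⟩
    obtain ⟨σ, rfl⟩ := hcov y
    refine ⟨σ, funext fun g => ?_⟩
    rw [LinearMap.funLeft_apply, hq, fibreSum_apply_eq_shadow_smul Φ r hr (q σ y₀) g]

omit [DecidableEq Y] [MulAction G X] [Fintype X] in
/-- The pull-back along a surjective orbit map is injective. [folklore] -/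
theorem funLeft_orbitMap_injective (y₀ : Y) (htrans : ∀ y : Y, ∃ g : G, g • y₀ = y) :
    Function.Injective (LinearMap.funLeft ℚ ℚ fun g : G => g • y₀) :=
  LinearMap.funLeft_injective_of_surjective _ _ _ fun y => htrans y

end Torsor

section Hecke

variable {I : Type u} {E : I → Type v} [∀ i, MulAction G (E i)] [Fintype I] [∀ i, Fintype (E i)]
  [∀ i, Nonempty (E i)] {Y : Type v'} [MulAction G Y] [DecidableEq Y] {Γ : Type*}

omit [Fintype I] [∀ i, Nonempty (E i)] in
/-- `dim(span{w₀ ∘ q_σ} ∩ span{w₁ ∘ q_σ}) = dim(F₀ ∩ F₁)` on a torsor. [cite: Shimura1998, §8.1 and §8.3] -/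
theorem finrank_inf_span_precomp_eq_finrank_inf_fibreSum (Φ : ∀ i, Set (E i)) {i₀ i₁ : I}
    (r₀ : E i₀ → Y) (r₁ : E i₁ → Y)
    (hr₀ : ∀ (g : G) (x : E i₀), r₀ (g • x) = g • r₀ x) (hr₁ : ∀ (g : G) (x : E i₁), r₁ (g • x) = g • r₁ x)
    (q : Γ → Y → Y) (hq : ∀ (σ : Γ) (g : G) (y : Y), q σ (g • y) = g • q σ y) (y₀ : Y)
    (hcov : ∀ y, ∃ σ, q σ y₀ = y) (htrans : ∀ y : Y, ∃ g : G, g • y₀ = y) :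
    Module.finrank ℚ (Submodule.span ℚ (Set.range fun σ : Γ => fun y : Y =>
          ∑ x ∈ Finset.univ.filter (fun x => r₀ x = q σ y), antiVec (Φ i₀) (1 : G) x) ⊓
        Submodule.span ℚ (Set.range fun σ : Γ => fun y : Y =>
          ∑ x ∈ Finset.univ.filter (fun x => r₁ x = q σ y), antiVec (Φ i₁) (1 : G) x) : Submodule ℚ (Y → ℚ)) =
      Module.finrank ℚ (Submodule.span ℚ (Set.range fun y : Y => fun g : G =>
            ∑ x ∈ Finset.univ.filter (fun x => r₀ x = y), antiVec (Φ i₀) g x) ⊓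
          Submodule.span ℚ (Set.range fun y : Y => fun g : G =>
            ∑ x ∈ Finset.univ.filter (fun x => r₁ x = y), antiVec (Φ i₁) g x) : Submodule ℚ (G → ℚ)) := by
  have hinj := funLeft_orbitMap_injective (G := G) y₀ htrans
  rw [← map_span_precomp_eq_span_fibreSum (Φ i₀) r₀ hr₀ q hq y₀ hcov,
    ← map_span_precomp_eq_span_fibreSum (Φ i₁) r₁ hr₁ q hq y₀ hcov, ← Submodule.map_inf _ hinj]
  exact LinearEquiv.finrank_eq (Submodule.equivMapOfInjective _ hinj _)

/-- **THE EXACT HECKE FORMULA.**  Two-slot family, pivot `Y` on which `G` is transitive, equivariant `r_κ : E_{i_κ} → Y`,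
maps `q_σ : Y → Y` commuting with `G` and reaching every point from `y₀` (`Y = Hom(M, ℂ)`, `M` normal, `q_δ = (· ∘ δ)`),
`N ≤ G` transitive on the fibres and inside the subgroup generated by the pointwise stabilisers.  Then
**`rank Φ₀ + rank Φ₁ = rank(Φ₀, Φ₁) + 1 + dim(span{w₀ ∘ q_σ} ∩ span{w₁ ∘ q_σ})`**, i.e.
**`dim Hg(A₀) + dim Hg(A₁) − dim Hg(A₀ × A₁) = dim(w₀ℚ[Γ] ∩ w₁ℚ[Γ])`** — the intersection of the RIGHT ideals generated by
the two shadows in the group ring of the torsor.  The criterion of `IrreducibleOddWeightsShadowIdealsHecke` is the case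
`= 0`. [cite: Gordon1999HodgeAVSurvey, §3 Theorem and 7.5–7.7] [cite: Kubota1965, §2 and §4] [cite: Shimura1998, §8.1 and §8.3] -/
theorem typeRank_add_typeRank_eq_finrank_inf_span_precomp_of_pivot {ρ : G} {Φ : ∀ i, Set (E i)}
    (h : ∀ i, IsCMTypeWith ρ (Φ i)) {i₀ i₁ : I} (hI : ∀ j, j = i₀ ∨ j = i₁) (h01 : i₀ ≠ i₁)
    (r₀ : E i₀ → Y) (r₁ : E i₁ → Y)
    (hr₀ : ∀ (g : G) (x : E i₀), r₀ (g • x) = g • r₀ x) (hr₁ : ∀ (g : G) (x : E i₁), r₁ (g • x) = g • r₁ x)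
    (N : Subgroup G) (hN₀ : ∀ x x' : E i₀, r₀ x = r₀ x' → ∃ n ∈ N, n • x = x')
    (hN₁ : ∀ x x' : E i₁, r₁ x = r₁ x' → ∃ n ∈ N, n • x = x')
    (hNcl : (N : Set G) ⊆ Subgroup.closure ({g : G | ∀ x : E i₀, g • x = x} ∪ {g : G | ∀ x : E i₁, g • x = x}))
    (q : Γ → Y → Y) (hq : ∀ (σ : Γ) (g : G) (y : Y), q σ (g • y) = g • q σ y) (y₀ : Y)
    (hcov : ∀ y, ∃ σ, q σ y₀ = y) (htrans : ∀ y : Y, ∃ g : G, g • y₀ = y) :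
    typeRank G (Φ i₀) + typeRank G (Φ i₁) = typeRank G (sigmaType Φ) + 1 +
      Module.finrank ℚ (Submodule.span ℚ (Set.range fun σ : Γ => fun y : Y =>
            ∑ x ∈ Finset.univ.filter (fun x => r₀ x = q σ y), antiVec (Φ i₀) (1 : G) x) ⊓
          Submodule.span ℚ (Set.range fun σ : Γ => fun y : Y =>
            ∑ x ∈ Finset.univ.filter (fun x => r₁ x = q σ y), antiVec (Φ i₁) (1 : G) x) : Submodule ℚ (Y → ℚ)) := by
  rw [finrank_inf_span_precomp_eq_finrank_inf_fibreSum Φ r₀ r₁ hr₀ hr₁ q hq y₀ hcov htrans]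
  exact typeRank_add_typeRank_eq_of_pivot h hI h01 r₀ r₁ N hN₀ hN₁ hNcl

/-- **Unconditional half of the Hecke formula**: `rank(Φ₀, Φ₁) + 1 + dim(span{w₀ ∘ q_σ} ∩ span{w₁ ∘ q_σ}) ≤ rank Φ₀ + rank Φ₁`
(torsor hypotheses only; no `N`): every independent common Hecke combination of the shadows is an independent drop of
`dim Hg(A₀ × A₁)`. [cite: Gordon1999HodgeAVSurvey, §3 Theorem (proof) and 7.5] -/
theorem typeRank_sigmaType_add_one_add_finrank_inf_span_precomp_le {ρ : G} {Φ : ∀ i, Set (E i)}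
    (h : ∀ i, IsCMTypeWith ρ (Φ i)) {i₀ i₁ : I} (hI : ∀ j, j = i₀ ∨ j = i₁) (h01 : i₀ ≠ i₁)
    (r₀ : E i₀ → Y) (r₁ : E i₁ → Y)
    (hr₀ : ∀ (g : G) (x : E i₀), r₀ (g • x) = g • r₀ x) (hr₁ : ∀ (g : G) (x : E i₁), r₁ (g • x) = g • r₁ x)
    (q : Γ → Y → Y) (hq : ∀ (σ : Γ) (g : G) (y : Y), q σ (g • y) = g • q σ y) (y₀ : Y)
    (hcov : ∀ y, ∃ σ, q σ y₀ = y) (htrans : ∀ y : Y, ∃ g : G, g • y₀ = y) :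
    typeRank G (sigmaType Φ) + 1 +
        Module.finrank ℚ (Submodule.span ℚ (Set.range fun σ : Γ => fun y : Y =>
            ∑ x ∈ Finset.univ.filter (fun x => r₀ x = q σ y), antiVec (Φ i₀) (1 : G) x) ⊓
          Submodule.span ℚ (Set.range fun σ : Γ => fun y : Y =>
            ∑ x ∈ Finset.univ.filter (fun x => r₁ x = q σ y), antiVec (Φ i₁) (1 : G) x) : Submodule ℚ (Y → ℚ)) ≤
      typeRank G (Φ i₀) + typeRank G (Φ i₁) := by
  rw [finrank_inf_span_precomp_eq_finrank_inf_fibreSum Φ r₀ r₁ hr₀ hr₁ q hq y₀ hcov htrans]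
  exact typeRank_sigmaType_add_one_add_finrank_inf_fibreSum_le h hI h01 r₀ r₁

end Hecke

end Summit.HodgeConjecture.CorCM.IrrOdd

end
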